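import Mathlib
import HarnessLib
import Summits.Ventures.LatticeQCDFlow.Exactness.IMHColdStartErrorBar
import Summits.Ventures.LatticeQCDFlow.Scaling.AutoregressiveGaugeAllClosingColdExact

/-!
# LatticeQCDFlow / Scaling — the cold-started exact all-closing conditioner: its explicit error bar,
# `E_cold[(A_N − π f)²] ≤ (2/A − 1)·Var_π f/N + (2/A² − 1/A)·δf²/N²`, `A = Z/∏_ℓ c_{#C_ℓ}`, and the Chebyshev deviation bound

HONEST FRAMING: exact (Metropolis-corrected) sampling algorithms for lattice gauge theory;
figures of merit are autocorrelation/cost numbers at stated couplings and volumes; no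
continuum-physics claim.

Venture `LatticeQCDFlow` (cell pub-lqcd), topic `Scaling`, FANOUT row 30 (lean-1, GEN-32) — OUR WORK, the gauge
instance of `Exactness/IMHColdStartErrorBar` (this generation).  Setting: `L ≥ 2`; `w` continuous, inversion-symmetric, `0 < m ≤ w ≤ M`; `(T, C)` a closing
assignment (every plaquette closed by exactly one link of `T`); target `π = (F/Z)·Haar^{⊗E}`, proposal `q` = the
all-closing conditioner, exact sampler `K = indepMH q (∏_ℓ N_ℓ/Z)⁻¹…` as in GEN-28 `allClosing_cold_acceptMass_eq`,
cold configuration `U ≡ 1` = the mode of the importance weight, `A = Z/∏_ℓ c_{#C_ℓ}` its acceptance mass;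
`f` bounded measurable, `δf = f(cold) − π f`, `Var_π f = ∫ (f − π f)² dπ`, `A_N = (1/N)Σ_{i<N} f(U_i)`, `N ≥ 1`.  The
Scoring row's any-start certificate with the exact sampler's exact Doeblin constant reads
`MSE ≤ (2/A − 1)·Var_π f/N + 16(C + |π f|)²/(A²N²)`; from the cold configuration the second-order term is the exact
sampler's own:

* **`allClosing_coldStart_errorBar`** — `E_cold[(A_N − π f)²] ≤ (2/A − 1)·Var_π f/N + (2/A² − 1/A)·δf²/N²`;
* **`allClosing_coldStart_deviation`** — `P_cold(|A_N − π f| ≥ a) ≤ [(2/A − 1)·Var_π f/N + (2/A² − 1/A)·δf²/N²]/a²` (`a > 0`):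
  a certified deviation bound for ONE cold-started run of the exact sampler in terms of `A`, `Var_π f`, `δf` only.

NOT CLAIMED: the values of `A`, `Var_π f`, `δf` for a specific weight (the lineage bounds `A` by dimension); tails
sharper than Chebyshev.  No `def`, no `sorry`, nothing cited as a fact beyond the tree.
-/

noncomputable section

namespace Summit.Ventures.LatticeQCDFlow.Theory2.Autoregressive

open MeasureTheory ProbabilityTheory Function Finset
open scoped ENNReal
open Literature.MathematicalPhysics.QuantumFieldTheory Literature.MathematicalPhysics.QuantumLattice
open Summit.Ventures.LatticeQCDFlow.Exactness Summit.Ventures.LatticeQCDFlow.Scoring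

variable {d L : ℕ} [NeZero L] {G : Type*} [Group G] [TopologicalSpace G] [IsTopologicalGroup G]
  [CompactSpace G] [SecondCountableTopology G] [MeasurableSpace G] [BorelSpace G]

/-- **`E_cold[(A_N − π f)²] ≤ (2/A − 1)·Var_π f/N + (2/A² − 1/A)·δf²/N²`** for the cold-started exact all-closing conditioner,
`A = Z/∏_ℓ c_{#C_ℓ}`, `N ≥ 1`. [ours] -/
theorem allClosing_coldStart_errorBar [MeasurableSingletonClass G] (hL : 2 ≤ L) {w : G → ℝ} (hw : Continuous w) {m M : ℝ} (hm0 : 0 < m)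
    (hm : ∀ g, m ≤ w g) (hM : ∀ g, w g ≤ M) (hwinv : ∀ g, w g⁻¹ = w g)
    (T : Finset (Edge d L)) (C : Edge d L → Finset (Plaquette d L))
    (hCne : ∀ ℓ ∈ T, (C ℓ).Nonempty)
    (hCe : ∀ ℓ ∈ T, ∀ p ∈ C ℓ, ℓ ∈ ({(p.1, p.2.1.1), (p.1.shift p.2.1.1, p.2.1.2),
        (p.1.shift p.2.1.2, p.2.1.1), (p.1, p.2.1.2)} : Finset (Edge d L)))
    (hdisj : ∀ ℓ ∈ T, ∀ ℓ' ∈ T, ℓ ≠ ℓ' → Disjoint (C ℓ) (C ℓ'))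
    (hcover : ∀ p : Plaquette d L, ∃ ℓ ∈ T, p ∈ C ℓ)
    (π q : Measure (GaugeConfig d L G)) [IsProbabilityMeasure π] [IsProbabilityMeasure q]
    (hπ : π = (Measure.pi fun _ : Edge d L => haarProbability G).withDensity fun U =>
      ENNReal.ofReal ((∏ p : Plaquette d L, w (plaquetteHolonomy U p.1 p.2.1.1 p.2.1.2)) /
        ∫ V, ∏ p : Plaquette d L, w (plaquetteHolonomy V p.1 p.2.1.1 p.2.1.2) ∂(Measure.pi fun _ : Edge d L => haarProbability G)))
    (hq : q = (Measure.pi fun _ : Edge d L => haarProbability G).withDensity fun U =>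
      ENNReal.ofReal (∏ ℓ ∈ T, (∏ p ∈ C ℓ, w (plaquetteHolonomy U p.1 p.2.1.1 p.2.1.2)) /
          (∫ v, ∏ p ∈ C ℓ, w (plaquetteHolonomy (update U ℓ v) p.1 p.2.1.1 p.2.1.2) ∂(haarProbability G))))
    [Fact (Measurable (fun U =>
        (((∫ V, ∏ p : Plaquette d L, w (plaquetteHolonomy V p.1 p.2.1.1 p.2.1.2) ∂(Measure.pi fun _ : Edge d L => haarProbability G)) /
          ∏ ℓ ∈ T, (∫ v, ∏ p ∈ C ℓ, w (plaquetteHolonomy (update U ℓ v) p.1 p.2.1.1 p.2.1.2) ∂(haarProbability G))))⁻¹))]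
    {f : GaugeConfig d L G → ℝ} (hf : Measurable f) {Cf : ℝ} (hCf : ∀ U, |f U| ≤ Cf) {N : ℕ} (hN : N ≠ 0) :
    ∫ x, ((∑ i ∈ Finset.range N, f (x i)) / N - ∫ U, f U ∂π) ^ 2 ∂(Kernel.trajMeasure (X := fun _ : ℕ => GaugeConfig d L G) (Measure.dirac (fun _ : Edge d L => (1 : G)))
        (fun n : ℕ => (indepMH q (fun U =>
        (((∫ V, ∏ p : Plaquette d L, w (plaquetteHolonomy V p.1 p.2.1.1 p.2.1.2) ∂(Measure.pi fun _ : Edge d L => haarProbability G)) /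
          ∏ ℓ ∈ T, (∫ v, ∏ p ∈ C ℓ, w (plaquetteHolonomy (update U ℓ v) p.1 p.2.1.1 p.2.1.2) ∂(haarProbability G))))⁻¹)).comap
          (fun h : (i : ↥(Finset.Iic n)) → GaugeConfig d L G => h ⟨n, Finset.mem_Iic.2 le_rfl⟩)
          (measurable_pi_apply _))) ≤
      (2 * ((∫ V, ∏ p : Plaquette d L, w (plaquetteHolonomy V p.1 p.2.1.1 p.2.1.2) ∂(Measure.pi fun _ : Edge d L => haarProbability G)) /
        ∏ ℓ ∈ T, ∫ h, w h ^ (C ℓ).card ∂(haarProbability G))⁻¹ - 1) *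
          (∫ U, (f U - ∫ V, f V ∂π) ^ 2 ∂π) / N +
        (2 * ((∫ V, ∏ p : Plaquette d L, w (plaquetteHolonomy V p.1 p.2.1.1 p.2.1.2) ∂(Measure.pi fun _ : Edge d L => haarProbability G)) /
        ∏ ℓ ∈ T, ∫ h, w h ^ (C ℓ).card ∂(haarProbability G))⁻¹ ^ 2 -
            ((∫ V, ∏ p : Plaquette d L, w (plaquetteHolonomy V p.1 p.2.1.1 p.2.1.2) ∂(Measure.pi fun _ : Edge d L => haarProbability G)) /
        ∏ ℓ ∈ T, ∫ h, w h ^ (C ℓ).card ∂(haarProbability G))⁻¹) *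
          (f (fun _ : Edge d L => (1 : G)) - ∫ U, f U ∂π) ^ 2 / (N : ℝ) ^ 2 := by
  obtain ⟨hA, hρq, hmax, hρm, hρpos⟩ := allClosing_cold_acceptMass_eq hL hw hm0 hm hM hwinv T C hCne hCe hdisj hcover π q hπ hq
  set cold : GaugeConfig d L G := fun _ => (1 : G) with hcold
  set ρ : GaugeConfig d L G → ℝ := fun U =>
    (∫ V, ∏ p : Plaquette d L, w (plaquetteHolonomy V p.1 p.2.1.1 p.2.1.2) ∂(Measure.pi fun _ : Edge d L => haarProbability G)) /
      ∏ ℓ ∈ T, (∫ v, ∏ p ∈ C ℓ, w (plaquetteHolonomy (update U ℓ v) p.1 p.2.1.1 p.2.1.2) ∂(haarProbability G)) with hρ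
  have hwm : Measurable fun U => (ρ U)⁻¹ := hρm.inv
  have hw0' : ∀ U, 0 < (ρ U)⁻¹ := fun U => inv_pos.2 (hρpos U)
  have hπ' : (q.withDensity fun U => ENNReal.ofReal (ρ U)⁻¹) = π := withDensity_inv_density hρm hρpos hρq
  haveI : IsProbabilityMeasure (q.withDensity fun U => ENNReal.ofReal (ρ U)⁻¹) := by rw [hπ']; infer_instance
  have hone : ∫⁻ y, ENNReal.ofReal (ρ y)⁻¹ ∂q = ENNReal.ofReal 1 := by
    have h : π Set.univ = 1 := measure_univ
    rw [← hπ', withDensity_apply _ MeasurableSet.univ, Measure.restrict_univ] at h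
    rw [h, ENNReal.ofReal_one]
  have hA' := imhAcceptMass_toReal_eq_of_forall_le (q := q) hw0' cold hmax zero_le_one hone
  have hrate : ((ρ cold)⁻¹)⁻¹ = (∫ V, ∏ p : Plaquette d L, w (plaquetteHolonomy V p.1 p.2.1.1 p.2.1.2) ∂(Measure.pi fun _ : Edge d L => haarProbability G)) /
        ∏ ℓ ∈ T, ∫ h, w h ^ (C ℓ).card ∂(haarProbability G) := by
    rw [← hA, hA', one_div]
  have hrate' : (ρ cold)⁻¹ = (((∫ V, ∏ p : Plaquette d L, w (plaquetteHolonomy V p.1 p.2.1.1 p.2.1.2) ∂(Measure.pi fun _ : Edge d L => haarProbability G)) /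
        ∏ ℓ ∈ T, ∫ h, w h ^ (C ℓ).card ∂(haarProbability G)))⁻¹ := by
    rw [← hrate, inv_inv]
  have h := imh_chain_mse_mode_le_explicit (q := q) hw0' hmax hf hCf hN (x₀ := cold)
  rw [hπ', hrate'] at h
  exact h

/-- **`P_cold(|A_N − π f| ≥ a) ≤ [(2/A − 1)·Var_π f/N + (2/A² − 1/A)·δf²/N²]/a²`** (`a > 0`, `N ≥ 1`) for the
cold-started exact all-closing conditioner. [ours] -/
theorem allClosing_coldStart_deviation [MeasurableSingletonClass G] (hL : 2 ≤ L) {w : G → ℝ} (hw : Continuous w) {m M : ℝ} (hm0 : 0 < m)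
    (hm : ∀ g, m ≤ w g) (hM : ∀ g, w g ≤ M) (hwinv : ∀ g, w g⁻¹ = w g)
    (T : Finset (Edge d L)) (C : Edge d L → Finset (Plaquette d L))
    (hCne : ∀ ℓ ∈ T, (C ℓ).Nonempty)
    (hCe : ∀ ℓ ∈ T, ∀ p ∈ C ℓ, ℓ ∈ ({(p.1, p.2.1.1), (p.1.shift p.2.1.1, p.2.1.2),
        (p.1.shift p.2.1.2, p.2.1.1), (p.1, p.2.1.2)} : Finset (Edge d L)))
    (hdisj : ∀ ℓ ∈ T, ∀ ℓ' ∈ T, ℓ ≠ ℓ' → Disjoint (C ℓ) (C ℓ'))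
    (hcover : ∀ p : Plaquette d L, ∃ ℓ ∈ T, p ∈ C ℓ)
    (π q : Measure (GaugeConfig d L G)) [IsProbabilityMeasure π] [IsProbabilityMeasure q]
    (hπ : π = (Measure.pi fun _ : Edge d L => haarProbability G).withDensity fun U =>
      ENNReal.ofReal ((∏ p : Plaquette d L, w (plaquetteHolonomy U p.1 p.2.1.1 p.2.1.2)) /
        ∫ V, ∏ p : Plaquette d L, w (plaquetteHolonomy V p.1 p.2.1.1 p.2.1.2) ∂(Measure.pi fun _ : Edge d L => haarProbability G)))
    (hq : q = (Measure.pi fun _ : Edge d L => haarProbability G).withDensity fun U =>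
      ENNReal.ofReal (∏ ℓ ∈ T, (∏ p ∈ C ℓ, w (plaquetteHolonomy U p.1 p.2.1.1 p.2.1.2)) /
          (∫ v, ∏ p ∈ C ℓ, w (plaquetteHolonomy (update U ℓ v) p.1 p.2.1.1 p.2.1.2) ∂(haarProbability G))))
    [Fact (Measurable (fun U =>
        (((∫ V, ∏ p : Plaquette d L, w (plaquetteHolonomy V p.1 p.2.1.1 p.2.1.2) ∂(Measure.pi fun _ : Edge d L => haarProbability G)) /
          ∏ ℓ ∈ T, (∫ v, ∏ p ∈ C ℓ, w (plaquetteHolonomy (update U ℓ v) p.1 p.2.1.1 p.2.1.2) ∂(haarProbability G))))⁻¹))]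
    {f : GaugeConfig d L G → ℝ} (hf : Measurable f) {Cf : ℝ} (hCf : ∀ U, |f U| ≤ Cf) {N : ℕ} (hN : N ≠ 0) {a : ℝ}
    (ha : 0 < a) :
    (Kernel.trajMeasure (X := fun _ : ℕ => GaugeConfig d L G) (Measure.dirac (fun _ : Edge d L => (1 : G)))
        (fun n : ℕ => (indepMH q (fun U =>
        (((∫ V, ∏ p : Plaquette d L, w (plaquetteHolonomy V p.1 p.2.1.1 p.2.1.2) ∂(Measure.pi fun _ : Edge d L => haarProbability G)) /
          ∏ ℓ ∈ T, (∫ v, ∏ p ∈ C ℓ, w (plaquetteHolonomy (update U ℓ v) p.1 p.2.1.1 p.2.1.2) ∂(haarProbability G))))⁻¹)).comap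
          (fun h : (i : ↥(Finset.Iic n)) → GaugeConfig d L G => h ⟨n, Finset.mem_Iic.2 le_rfl⟩)
          (measurable_pi_apply _))).real
        {x | a ≤ |(∑ i ∈ Finset.range N, f (x i)) / N - ∫ U, f U ∂π|} ≤
      ((2 * ((∫ V, ∏ p : Plaquette d L, w (plaquetteHolonomy V p.1 p.2.1.1 p.2.1.2) ∂(Measure.pi fun _ : Edge d L => haarProbability G)) /
        ∏ ℓ ∈ T, ∫ h, w h ^ (C ℓ).card ∂(haarProbability G))⁻¹ - 1) *
            (∫ U, (f U - ∫ V, f V ∂π) ^ 2 ∂π) / N +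
          (2 * ((∫ V, ∏ p : Plaquette d L, w (plaquetteHolonomy V p.1 p.2.1.1 p.2.1.2) ∂(Measure.pi fun _ : Edge d L => haarProbability G)) /
        ∏ ℓ ∈ T, ∫ h, w h ^ (C ℓ).card ∂(haarProbability G))⁻¹ ^ 2 -
              ((∫ V, ∏ p : Plaquette d L, w (plaquetteHolonomy V p.1 p.2.1.1 p.2.1.2) ∂(Measure.pi fun _ : Edge d L => haarProbability G)) /
        ∏ ℓ ∈ T, ∫ h, w h ^ (C ℓ).card ∂(haarProbability G))⁻¹) *
            (f (fun _ : Edge d L => (1 : G)) - ∫ U, f U ∂π) ^ 2 / (N : ℝ) ^ 2) / a ^ 2 := by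
  obtain ⟨hA, hρq, hmax, hρm, hρpos⟩ := allClosing_cold_acceptMass_eq hL hw hm0 hm hM hwinv T C hCne hCe hdisj hcover π q hπ hq
  set cold : GaugeConfig d L G := fun _ => (1 : G) with hcold
  set ρ : GaugeConfig d L G → ℝ := fun U =>
    (∫ V, ∏ p : Plaquette d L, w (plaquetteHolonomy V p.1 p.2.1.1 p.2.1.2) ∂(Measure.pi fun _ : Edge d L => haarProbability G)) /
      ∏ ℓ ∈ T, (∫ v, ∏ p ∈ C ℓ, w (plaquetteHolonomy (update U ℓ v) p.1 p.2.1.1 p.2.1.2) ∂(haarProbability G)) with hρ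
  have hwm : Measurable fun U => (ρ U)⁻¹ := hρm.inv
  have hw0' : ∀ U, 0 < (ρ U)⁻¹ := fun U => inv_pos.2 (hρpos U)
  have hπ' : (q.withDensity fun U => ENNReal.ofReal (ρ U)⁻¹) = π := withDensity_inv_density hρm hρpos hρq
  haveI : IsProbabilityMeasure (q.withDensity fun U => ENNReal.ofReal (ρ U)⁻¹) := by rw [hπ']; infer_instance
  have hone : ∫⁻ y, ENNReal.ofReal (ρ y)⁻¹ ∂q = ENNReal.ofReal 1 := by
    have h : π Set.univ = 1 := measure_univ
    rw [← hπ', withDensity_apply _ MeasurableSet.univ, Measure.restrict_univ] at h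
    rw [h, ENNReal.ofReal_one]
  have hA' := imhAcceptMass_toReal_eq_of_forall_le (q := q) hw0' cold hmax zero_le_one hone
  have hrate : ((ρ cold)⁻¹)⁻¹ = (∫ V, ∏ p : Plaquette d L, w (plaquetteHolonomy V p.1 p.2.1.1 p.2.1.2) ∂(Measure.pi fun _ : Edge d L => haarProbability G)) /
        ∏ ℓ ∈ T, ∫ h, w h ^ (C ℓ).card ∂(haarProbability G) := by
    rw [← hA, hA', one_div]
  have hrate' : (ρ cold)⁻¹ = (((∫ V, ∏ p : Plaquette d L, w (plaquetteHolonomy V p.1 p.2.1.1 p.2.1.2) ∂(Measure.pi fun _ : Edge d L => haarProbability G)) /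
        ∏ ℓ ∈ T, ∫ h, w h ^ (C ℓ).card ∂(haarProbability G)))⁻¹ := by
    rw [← hrate, inv_inv]
  have h := imh_chain_deviation_mode_le (q := q) hw0' hmax hf hCf hN ha (x₀ := cold)
  rw [hπ', hrate'] at h
  exact h

end Summit.Ventures.LatticeQCDFlow.Theory2.Autoregressive

end
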